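import Literature.NumberTheory.EllipticCurves.GreenbergVatsal2000.NonPrimitiveSelmerGroup
import Literature.NumberTheory.EllipticCurves.Tamagawa
import Literature.NumberTheory.EllipticCurves.GlobalMinimalModel
import HarnessLib

/-!
# Greenberg–Vatsal, *On the Iwasawa invariants of elliptic curves* (Invent. Math. 142 (2000)),
# §1 (6)–(7) p. 7–8 (proved in §2, Cor. (2.3) + Prop. (2.4), pp. 20–22, 26): the Iwasawa invariants
# of the NON-PRIMITIVE Selmer group — `μ^{alg}_{E,Σ₀} = μ^{alg}_E` and
# `λ^{alg}_{E,Σ₀} = λ^{alg}_E + Σ_{ℓ∈Σ₀} δ_E^{(ℓ)}`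

HONEST FRAMING (BSD rank-`≤ 1` residual cell `b2b-bsdres`, home
`run/shared/lean/b2b/bsd-rank1-residual/`, unit `b2b-bsdres-eisenstein-p2`): the cell deletes the
COMBINATION-SHAPED residual classes of the rank-`≤ 1` BSD formula from PUBLISHED theorems only and
TYPES the construction-shaped ones; this is not "finishing BSD". This file records ONE published
statement as a named fact (`def … : Prop`, nothing asserted; D-0014/D-0026): Greenberg–Vatsal's
relationships (6)–(7) between the primitive and the non-primitive Selmer groups of an elliptic
curve `E/ℚ` over the cyclotomic `ℤ_p`-extension, in the tree's vocabulary — for the `Λ`-module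
`X = Sel_E(ℚ_∞)_p^` (any `WeierstrassCurve.SelmerDualData`, file `IwasawaSelmer`) and the
`Λ`-module `X^{Σ₀} = Sel^{Σ₀}_E(ℚ_∞)_p^` (any `GreenbergVatsal2000.NonPrimitiveDualData`, file
`NonPrimitiveSelmerGroup`): if `X` is `Λ`-torsion (GV's standing hypothesis "`Sel_E(ℚ_∞)_p` is
`Λ`-cotorsion", Kato) then `X^{Σ₀}` is finitely generated and `Λ`-torsion,
`μ(X^{Σ₀}) = μ(X)` and `λ(X^{Σ₀}) = λ(X) + Σ_{ℓ∈Σ₀} δ_E^{(ℓ)}`, with `δ_E^{(ℓ)} = s_ℓ d_ℓ`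
(`GreenbergVatsal2000.delta`, GV Prop. (2.4)). It is the one §2 input of route G's KERNEL derivation
of the typed transfer `X1.CongruenceTransfer.CongruentLambdaShift`
(`Summits/BirchSwinnertonDyer/Rank1Residual/X2/CongruentLambdaShiftDerived.lean`) that concerns the
local groups `𝓗_ℓ(ℚ_∞)`, `ℓ ∈ Σ₀`; the divisibility of `Sel^{Σ₀}` at `μ = 0` (GV p. 8 / Prop. (2.8))
is the sibling fact `NonPrimitiveSelmerDivisible`, and everything else is a tree theorem.

## Citation header (read by this seat on the held text arXiv:math/9906215 =
## `paper:arxiv-math_9906215`, dvips stream decoded by the cell, `b2b-bsdres-lit/u1/gv2000_decoded.txt`;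
## page numbers of the arXiv typescript)

* GV §1 p. 7: "For `ℓ ≠ p`, it can be shown that `𝓗_ℓ(ℚ_∞)` is `Λ`-cotorsion, and has `μ`-invariant
  `0`. … It turns out in fact that `𝓗_ℓ(ℚ_∞) ≅ (ℚ_p/ℤ_p)^{δ_E^{(ℓ)}}`, where `δ_E^{(ℓ)}` is a
  non-negative integer which is easily determined from the Euler factor for `ℓ` in `L(E/ℚ, s)`. Let
  `h_E^{(ℓ)}(T) ∈ Λ` denote the characteristic polynomial for the `Λ`-module `𝓗_ℓ(ℚ_∞)^` … This
  polynomial has degree `δ_E^{(ℓ)}`. … Assuming that `Sel_E(ℚ_∞)_p` is `Λ`-cotorsion (which has been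
  proven by Kato when `E` is modular and has good or multiplicative reduction at `p`), one can show
  that the map (4) defining the Selmer group is surjective. It follows that
  `Sel^{Σ₀}_E(ℚ_∞)_p / Sel_E(ℚ_∞)_p ≅ ∏_{ℓ∈Σ₀} 𝓗_ℓ(ℚ_∞)`. (5) Consequently, if we denote the
  characteristic polynomial of the `Λ`-module `Sel^{Σ₀}_E(ℚ_∞)_p^` by `f^{alg}_{E,Σ₀}(T)`, then we
  have `f^{alg}_{E,Σ₀}(T) = f^{alg}_E(T) ∏_{ℓ∈Σ₀} h_E^{(ℓ)}(T)`, (6)"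
* GV §1 p. 8: "and the `λ`-invariant of `Sel^{Σ₀}_E(ℚ_∞)_p`, which we denote by `λ^{alg}_{E,Σ₀}`, is
  given by `λ^{alg}_{E,Σ₀} = λ^{alg}_E + Σ_{ℓ∈Σ₀} δ_E^{(ℓ)}`. (7) As for the `μ`-invariant, it is
  obvious that `μ^{alg}_E = μ^{alg}_{E,Σ₀}`."
* GV §2 Cor. (2.3), p. 20: "With assumptions as in (2.1) [`S_A(ℚ_∞)` is `Λ`-cotorsion and
  `H⁰(ℚ_∞, A*)` is finite], we have `S^{Σ₀}_A(ℚ_∞)/S_A(ℚ_∞) ≅ ∏_{ℓ∈Σ₀} 𝓗_ℓ(ℚ_∞)`"; Prop. (2.4),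
  p. 22: "The characteristic ideal of the `Λ`-module `𝓗_ℓ(ℚ_∞)^` is generated by `𝒫_ℓ`. Its
  `μ`-invariant is zero. Its `λ`-invariant is equal to `s_ℓ d_ℓ`."; p. 26: "Assume that `E` has good
  ordinary reduction at `p`. … `Sel_E(ℚ_∞)_p = S_A(ℚ_∞)`. The nonprimitive Selmer groups
  `Sel^{Σ₀}_E(ℚ_∞)_p` and `S^{Σ₀}_A(ℚ_∞)` also coincide … By Kato's theorem, `S_A(ℚ_∞)` is
  `Λ`-cotorsion. Also, `H⁰(ℚ_∞, A*)` is finite since `A* ≅ E[p^∞]` by the Weil pairing and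
  `E(ℚ_∞)_tors` is known to be finite. … Corollary (2.3) then implies the important relationships
  (6) and (7). By proposition (2.4), `𝒫_ℓ(T)` is a generator of the characteristic ideal of
  `𝓗_ℓ(ℚ_∞)^`."

## The tree's vocabulary (no new definition)

`E/ℚ` globally minimal (`W.IsGloballyMinimal`), `p` odd of good ORDINARY reduction
(`W.HasGoodReductionAtPrime p`, `p ∤ a_p = W.frobeniusTrace p`), `κ : ZpExtension ℚ p` cyclotomic
with topological generator `γ` (`κ.IsCyclotomic`, `κ.IsTopGenerator γ`), `Σ₀` a finite set of finite
places not above `p`; `D : W.SelmerDualData κ γ` (`D.X = Sel_E(ℚ_∞)_p^ = X`, `D.IsTorsion` = "`Λ`-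
cotorsion"), `DS : NonPrimitiveDualData W κ γ Σ₀` (`DS.X = Sel^{Σ₀}_E(ℚ_∞)_p^`); `muInvariant`,
`lambdaInvariant` (file `IwasawaAlgebra`); `delta W p v = s_ℓ d_ℓ` (file `NonPrimitiveSelmerGroup`,
`ℓ = natGenerator v`, `d_ℓ` read off Mathlib's `W.localPolynomialAt v` mod `p` — GV's
`P_ℓ(X) = det((1 - Frob_ℓ X)|(V_p)_{I_ℓ})` is that Euler factor by the tree theorem
`WeierstrassCurve.reverse_charpoly_toInertiaCoinvariants_eq_localPolynomialAt`).
-/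

noncomputable section

open scoped Classical

open NumberField IsDedekindDomain Field WeierstrassCurve
  Literature.NumberTheory.EllipticCurves.GreenbergVatsal2000

namespace Literature.NumberTheory.EllipticCurves.GreenbergVatsal2000

/-- **Greenberg–Vatsal 2000, (6)–(7) (§1 p. 7–8; §2 Cor. (2.3), Prop. (2.4), p. 26): the Iwasawa
invariants of the non-primitive Selmer group.** "Assuming that `Sel_E(ℚ_∞)_p` is `Λ`-cotorsion …
`Sel^{Σ₀}_E(ℚ_∞)_p/Sel_E(ℚ_∞)_p ≅ ∏_{ℓ∈Σ₀} 𝓗_ℓ(ℚ_∞)` (5) …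
`f^{alg}_{E,Σ₀}(T) = f^{alg}_E(T) ∏_{ℓ∈Σ₀} h_E^{(ℓ)}(T)` (6) … `λ^{alg}_{E,Σ₀} = λ^{alg}_E + Σ_{ℓ∈Σ₀} δ_E^{(ℓ)}`
(7) … it is obvious that `μ^{alg}_E = μ^{alg}_{E,Σ₀}`", where `𝓗_ℓ(ℚ_∞)^` is `Λ`-torsion with `μ = 0`
and `λ = δ_E^{(ℓ)} = s_ℓ d_ℓ` (Prop. (2.4)). In the tree's vocabulary: for a globally minimal elliptic
`E/ℚ`, an ODD prime `p` of good ordinary reduction, the cyclotomic `ℤ_p`-extension `κ` with a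
topological generator `γ`, a finite set `Σ₀` of finite places not above `p`, ANY Pontryagin-dual
datum `D` of `Sel_{p^∞}(E/ℚ_∞)` whose Iwasawa module `D.X` is finitely generated and `Λ`-TORSION,
and ANY Pontryagin-dual datum `DS` of the non-primitive Selmer group `Sel^{Σ₀}_E(ℚ_∞)_p`
(`NonPrimitiveDualData`): `DS.X` is finitely generated and `Λ`-torsion, `μ(DS.X) = μ(D.X)`, and
`λ(DS.X) = λ(D.X) + Σ_{v∈Σ₀} δ_E^{(v)}`.
-- TODO(general form): GV prove the `Λ`-module statements (5) (the quotient IS `∏_{ℓ∈Σ₀} 𝓗_ℓ(ℚ_∞)`,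
-- Cor. (2.3)) and (6) (characteristic polynomials), for `A = V_p/T_p` of any `p`-adic Galois
-- representation with `S_A(ℚ_∞)` cotorsion and `H⁰(ℚ_∞, A*)` finite (for `A = E[p^∞]` the latter
-- is automatic, p. 26); only the invariants (7) and `μ_{E,Σ₀} = μ_E` are transcribed, at good
-- ordinary odd `p` over `ℚ`.
[cite: GreenbergVatsal2000, §1 (6)–(7) p. 7–8; §2 Cor. (2.3), Prop. (2.4) (pp. 20–22), p. 26] -/
def lambda_nonPrimitive_eq_add_sum_delta : Prop :=
  ∀ (W : WeierstrassCurve ℚ) [W.IsElliptic] [W.IsGloballyMinimal] (p : ℕ) [Fact p.Prime]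
    (_hp : p ≠ 2) (_hgood : W.HasGoodReductionAtPrime p) (_hord : ¬ (p : ℤ) ∣ W.frobeniusTrace p)
    (κ : ZpExtension ℚ p) (_hκ : κ.IsCyclotomic) (γ : absoluteGaloisGroup ℚ)
    (_hγ : κ.IsTopGenerator γ) (S₀ : Finset (HeightOneSpectrum (𝓞 ℚ)))
    (_hS₀ : ∀ v ∈ S₀, ((p : ℕ) : 𝓞 ℚ) ∉ v.asIdeal)
    (D : W.SelmerDualData κ γ) [Module.Finite (IwasawaAlgebra p) D.X]
    (DS : NonPrimitiveDualData W κ γ (↑S₀ : Set (HeightOneSpectrum (𝓞 ℚ)))),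
    D.IsTorsion →
      Module.Finite (IwasawaAlgebra p) DS.X ∧ Module.IsTorsion (IwasawaAlgebra p) DS.X ∧
        muInvariant p DS.X = muInvariant p D.X ∧
        lambdaInvariant p DS.X = lambdaInvariant p D.X + ∑ v ∈ S₀, delta W p v

end Literature.NumberTheory.EllipticCurves.GreenbergVatsal2000

end
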